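import Summits.Langlands.Langlands.Theses.AuxiliaryLevelSplit

/-!
# Route AuxiliaryLevelSplit — Assembly

The assembly item (stmt-Langlands-27043) of the child route `AuxiliaryLevelSplit` (decomp-langlands lens-3 gen 20; V-R refining child
`--refines route-Langlands-DepthPrimeSplit:FernSpread`, 92nd cell route, third thaw slot 2026-08-31) for
FERN = `DepthPrimeSplit.FernSpread` (stmt-Langlands-25024):
`LevelFreeFern → LevelFiniteness → Summit.Langlands.Langlands.Theses.DepthPrimeSplit.FernSpread`
(G: residually automorphic data are pro-automorphic of unbounded level; U: pro-automorphy of unbounded level implies pro-automorphy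
of bounded level = FERN's conclusion).

This is literally the type of the route file's sorry-free deciding theorem `Summit.Langlands.Langlands.Theses.AuxiliaryLevelSplit.closes`.
Nothing here proves `Langlands` (nor FERN): the assembly records only that the two cells of the route, taken together, imply the parent
piece by name.
-/

set_option linter.dupNamespace false -- project-wide option (lakefile weak.linter.dupNamespace); `Summit.Langlands.Langlands` is the mandated namespace

namespace Summit.Langlands.Langlands.Theorems

/-- **Assembly of route AuxiliaryLevelSplit** (stmt-Langlands-27043):
`LevelFreeFern → LevelFiniteness → Summit.Langlands.Langlands.Theses.DepthPrimeSplit.FernSpread`.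
Proof: unfold `Assembly` and apply the route's deciding theorem `Theses.AuxiliaryLevelSplit.closes`. -/
theorem auxiliaryLevelSplit_assembly_proof :
    Summit.Langlands.Langlands.Theses.AuxiliaryLevelSplit.Assembly := by
  unfold Summit.Langlands.Langlands.Theses.AuxiliaryLevelSplit.Assembly
  exact Summit.Langlands.Langlands.Theses.AuxiliaryLevelSplit.closes

end Summit.Langlands.Langlands.Theorems
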